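import Summits.BirchSwinnertonDyer.Rank1Residual.Additive.PadicBallLog
import HarnessLib

/-!
# K-PORT glue (G2): the SATURATED logarithm `Λ̃(P) = Λ(n•P)/n` on the points of `E(K)` a multiple
# of which lies in the kernel of reduction `E₁(K)` — the extension of `log_ω` from `E₁(K)` to
# `E₀(K)` (and to all of `E(K)` for a finite residue field) over a complete ultrametric `ℚ_p`-field
# (cell `bsd-addord`, seat w2-kport gen 0; `--supports stmt-BirchSwinnertonDyer-19560`, helper)

HONEST FRAMING. Route W2 (`route-BirchSwinnertonDyer-KimAtThreeKolyvagin`), crux 19560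
`KatoKuriharaPortThreeShared`, residual ⟨C1⟩ clause (C1.c): LEMMA SAT₀'s E-side wants, over the
unramified completions `K = K_w ⊇ ℚ₃`, a logarithm on `E₀(K) ⊋ E₁(K)` (kim3 brief KIM3-KPORT-BRIEF-g12
§3 (P2): "define log on `E₀(K)` by `log P := L(9•P)/9` … additivity, equivariance, `‖log P‖ ≤ 1` on
`E₀(K)`"). The x1b local series gives `Λ = BallEval.ptLog p K M = log_E ∘ z` on `E₁(K)` only
(`BallEval.ptLog_add`, `ptLog_nsmul`). This file extends it to the SATURATION
`Ẽ₁(K) = {P ∈ E(K) : ∃ n ≥ 1, n•P ∈ E₁(K)}` — which contains `E₀(K)` at additive reduction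
(`p • E₀ ⊆ E₁`) and is all of `E(K)` when `K/ℚ_p` is finite — by `Λ̃(P) = Λ(n•P)/n`, exactly as the
tree's `LocalLog.padicLog` extends the limit logarithm on `ℚ_p`-points (`Additive/PadicLogImage`).
TOOL definitions + theorems (three definitions with bodies: `satKernel`, `satLog`, `satLogHom`; no
named fact, no `sorry`); closes nothing by itself; nothing booked.

## What is here (`E = BallEval.curveK p K M`, `E₁(K) = FormalGroupChart.kernel`, `Λ = BallEval.ptLog p K M`)

* §1 `satKernel p K M : AddSubgroup` — `Ẽ₁(K)`; `mem_satKernel_iff`, `kernel_le_satKernel`,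
  `mem_satKernel_of_nsmul_mem`.
* §2 `satLog p K M : E(K) → K` — `Λ̃(P) = Λ(n•P)/n` for any `n ≥ 1` with `n•P ∈ E₁(K)` (junk `0` off
  `Ẽ₁(K)`); **`satLog_eq_div`** (independence of `n`, from `Λ(m•Q) = mΛ(Q)`), `satLog_of_mem`
  (`Λ̃ = Λ` on `E₁(K)`), `satLog_zero`, `satLog_of_not_mem`.
* §3 **`satLog_add`** on `Ẽ₁(K)` (from `BallEval.ptLog_add`); `satLogHom : Ẽ₁(K) →+ K`; `satLog_neg`,
  `satLog_sub`, `satLog_nsmul`.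
* §4 bounds: `norm_satLog_le_of_norm_ptLog_le` (`‖Λ(n•P)‖ ≤ B‖n‖ ⇒ ‖Λ̃ P‖ ≤ B`), and the shape used
  by SAT₀: `norm_satLog_le_of_prime_nsmul` (`p•P ∈ E₁(K)`, `‖Λ(p•P)‖ ≤ ‖p‖ ⇒ ‖Λ̃ P‖ ≤ 1`).

Equivariance of `Λ̃` and the values `‖Λ̃‖ ≤ 1` on `E₀(K)` for an UNRAMIFIED `K` at an ADDITIVE prime are
the sibling files `KimAtThreeFineKatoKPortEquivariance` / `…KPortUnramified`.

References: J. H. Silverman, *The Arithmetic of Elliptic Curves*, 2nd ed. (2009), IV.6.4, VII.2.1–2.2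
[SilvermanAEC2009]; C.-H. Kim, AJM 148 (2026) §3.2.3 (the `ℤ_p`-linear extension `log_ω`)
[Kim2022StructureSelmer]; kim3 brief HOME/kim3/KIM3-KPORT-BRIEF-g12.md §3 (P2).
-/

noncomputable section

-- the cell's Theorems namespace `Summit.BirchSwinnertonDyer.BirchSwinnertonDyer.…` repeats the summit name by design (D-0017)
set_option linter.dupNamespace false

open scoped Classical

namespace Summit.BirchSwinnertonDyer.BirchSwinnertonDyer.Theorems.KPort

open Summit.BirchSwinnertonDyer.Rank1Residual.Additive.BallEval
open Literature.NumberTheory.GaloisRepresentations.LubinTate (unitBall mem_unitBall_iff)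
open Literature.NumberTheory.EllipticCurves Literature.NumberTheory.EllipticCurves.FormalGroupChart
open WeierstrassCurve

variable (p : ℕ) [hp : Fact p.Prime] (K : Type*) [NontriviallyNormedField K] [NormedAlgebra ℚ_[p] K]
  [IsUltrametricDist K] [CompleteSpace K] (M : WeierstrassCurve ℤ_[p])
  [hint : (curveK p K M).IsIntegral (NormedField.valuation (K := K)).integer]

/-! ## §1 The saturation `Ẽ₁(K)` of the kernel of reduction -/

/-- **`Ẽ₁(K) = {P ∈ E(K) : n • P ∈ E₁(K) for some n ≥ 1}`**, the saturation of the kernel of reduction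
in the Mordell–Weil group: a subgroup (if `m•P, n•Q ∈ E₁` then `mn•(P+Q) ∈ E₁`). It contains `E₀(K)`
at a prime of additive reduction (`p•E₀(K) ⊆ E₁(K)`, Silverman VII.2.1 with `Ẽ_ns ≅ 𝔾ₐ`) and is all
of `E(K)` when the residue field is finite (`E(K)/E₁(K)` finite, VII.2.1/VII.6.3).
[cite: SilvermanAEC2009, Prop. VII.2.1 and VII.2.2] -/
def satKernel : AddSubgroup (curveK p K M).toAffine.Point where
  carrier := {P | ∃ n : ℕ, 0 < n ∧ n • P ∈ kernel (NormedField.valuation (K := K)) (curveK p K M)}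
  zero_mem' := ⟨1, one_pos, by
    rw [nsmul_zero]; exact (kernel (NormedField.valuation (K := K)) (curveK p K M)).zero_mem⟩
  add_mem' := by
    rintro P Q ⟨m, hm, hmP⟩ ⟨n, hn, hnQ⟩
    refine ⟨m * n, Nat.mul_pos hm hn, ?_⟩
    have hP' : n • m • P ∈ kernel (NormedField.valuation (K := K)) (curveK p K M) :=
      (kernel (NormedField.valuation (K := K)) (curveK p K M)).nsmul_mem hmP n
    have hQ' : m • n • Q ∈ kernel (NormedField.valuation (K := K)) (curveK p K M) :=
      (kernel (NormedField.valuation (K := K)) (curveK p K M)).nsmul_mem hnQ m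
    have h : n • m • P + m • n • Q ∈ kernel (NormedField.valuation (K := K)) (curveK p K M) :=
      (kernel (NormedField.valuation (K := K)) (curveK p K M)).add_mem hP' hQ'
    rwa [← mul_nsmul, ← mul_nsmul', ← nsmul_add] at h
  neg_mem' := by
    rintro P ⟨n, hn, hnP⟩
    refine ⟨n, hn, ?_⟩
    have h : -(n • P) ∈ kernel (NormedField.valuation (K := K)) (curveK p K M) :=
      (kernel (NormedField.valuation (K := K)) (curveK p K M)).neg_mem hnP
    rwa [← neg_nsmul] at h

variable {p K M}

omit [CompleteSpace K] in
/-- Membership in `Ẽ₁(K)`. [folklore] -/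
theorem mem_satKernel_iff {P : (curveK p K M).toAffine.Point} :
    P ∈ satKernel p K M ↔
      ∃ n : ℕ, 0 < n ∧ n • P ∈ kernel (NormedField.valuation (K := K)) (curveK p K M) :=
  Iff.rfl

omit [CompleteSpace K] in
/-- `n • P ∈ E₁(K)` with `n ≥ 1` puts `P` in `Ẽ₁(K)`. [folklore] -/
theorem mem_satKernel_of_nsmul_mem {P : (curveK p K M).toAffine.Point} {n : ℕ} (hn : 0 < n)
    (hP : n • P ∈ kernel (NormedField.valuation (K := K)) (curveK p K M)) : P ∈ satKernel p K M :=
  ⟨n, hn, hP⟩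

omit [CompleteSpace K] in
/-- `E₁(K) ≤ Ẽ₁(K)`. [folklore] -/
theorem kernel_le_satKernel :
    kernel (NormedField.valuation (K := K)) (curveK p K M) ≤ satKernel p K M :=
  fun _ hP => ⟨1, one_pos, by rw [one_nsmul]; exact hP⟩

/-! ## §2 The saturated logarithm -/

variable (p K M) in
/-- **The saturated logarithm `Λ̃(P) = Λ(n • P)/n`** (`n ≥ 1` any integer with `n • P ∈ E₁(K)`; junk
value `0` when there is none, i.e. off `Ẽ₁(K)`), where `Λ = BallEval.ptLog = log_E ∘ z` is the
logarithm of the formal group on `E₁(K)`. Independent of `n` (`satLog_eq_div`) because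
`Λ(m • Q) = m Λ(Q)` on `E₁(K)`; it is the unique homomorphism `Ẽ₁(K) → K` extending `Λ`
(`satLog_of_mem`, `satLog_add`) — the `ℤ_p`-linear extension `log_ω` of Kato / C.-H. Kim §3.2.3, over
`K` (the tree's `LocalLog.padicLog` is the case `K = ℚ_p`). [cite: SilvermanAEC2009, IV.6.4 and Prop. VII.2.2] -/
def satLog (P : (curveK p K M).toAffine.Point) : K :=
  if h : ∃ n : ℕ, 0 < n ∧ n • P ∈ kernel (NormedField.valuation (K := K)) (curveK p K M) then
    ptLog p K M (h.choose • P) / h.choose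
  else 0

variable [hE : (M.map PadicInt.Coe.ringHom).IsElliptic]

/-- Cross-multiplication: `n Λ(m•P) = m Λ(n•P)` when `m•P, n•P ∈ E₁(K)` (both are `Λ(mn•P)`).
[cite: SilvermanAEC2009, IV.6.4] -/
theorem nat_mul_ptLog_nsmul_comm {P : (curveK p K M).toAffine.Point} {m n : ℕ}
    (hm : m • P ∈ kernel (NormedField.valuation (K := K)) (curveK p K M))
    (hn : n • P ∈ kernel (NormedField.valuation (K := K)) (curveK p K M)) :
    (n : K) * ptLog p K M (m • P) = (m : K) * ptLog p K M (n • P) := by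
  rw [← ptLog_nsmul hm n, ← ptLog_nsmul hn m, ← mul_nsmul', ← mul_nsmul]

/-- **`Λ̃(P) = Λ(n•P)/n` for ANY `n ≥ 1` with `n•P ∈ E₁(K)`** (independence of the auxiliary multiple).
[cite: SilvermanAEC2009, IV.6.4 and Prop. VII.2.2] -/
theorem satLog_eq_div {P : (curveK p K M).toAffine.Point} {n : ℕ} (hn : 0 < n)
    (hP : n • P ∈ kernel (NormedField.valuation (K := K)) (curveK p K M)) :
    satLog p K M P = ptLog p K M (n • P) / n := by
  haveI : CharZero K := charZero_of_injective_algebraMap (algebraMap ℚ_[p] K).injective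
  have h : ∃ n : ℕ, 0 < n ∧ n • P ∈ kernel (NormedField.valuation (K := K)) (curveK p K M) :=
    ⟨n, hn, hP⟩
  rw [satLog, dif_pos h]
  obtain ⟨hm, hmP⟩ := h.choose_spec
  have hm0 : (h.choose : K) ≠ 0 := Nat.cast_ne_zero.mpr hm.ne'
  have hn0 : (n : K) ≠ 0 := Nat.cast_ne_zero.mpr hn.ne'
  rw [div_eq_div_iff hm0 hn0, mul_comm, nat_mul_ptLog_nsmul_comm hmP hP, mul_comm]

/-- **`Λ̃ = Λ` on `E₁(K)`.** [folklore] -/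
theorem satLog_of_mem {P : (curveK p K M).toAffine.Point}
    (hP : P ∈ kernel (NormedField.valuation (K := K)) (curveK p K M)) :
    satLog p K M P = ptLog p K M P := by
  rw [satLog_eq_div one_pos (by rw [one_nsmul]; exact hP), one_nsmul, Nat.cast_one, div_one]

/-- `Λ̃(O) = 0`. [folklore] -/
theorem satLog_zero : satLog p K M 0 = 0 := by
  rw [satLog_of_mem (kernel (NormedField.valuation (K := K)) (curveK p K M)).zero_mem, ptLog_zero]

omit [CompleteSpace K] hE in
/-- Off `Ẽ₁(K)` the saturated logarithm takes the junk value `0`. [folklore] -/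
theorem satLog_of_not_mem {P : (curveK p K M).toAffine.Point} (hP : P ∉ satKernel p K M) :
    satLog p K M P = 0 := by
  rw [satLog, dif_neg]
  exact hP

/-! ## §3 Additivity -/

/-- **`Λ̃(P + Q) = Λ̃(P) + Λ̃(Q)` on `Ẽ₁(K)`** (with `N = mn`, `N•(P+Q) = N•P + N•Q` in `E₁(K)` and
`BallEval.ptLog_add`). [cite: SilvermanAEC2009, IV.6.4 and Prop. VII.2.2] -/
theorem satLog_add {P Q : (curveK p K M).toAffine.Point} (hP : P ∈ satKernel p K M)
    (hQ : Q ∈ satKernel p K M) : satLog p K M (P + Q) = satLog p K M P + satLog p K M Q := by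
  haveI : CharZero K := charZero_of_injective_algebraMap (algebraMap ℚ_[p] K).injective
  obtain ⟨m, hm, hmP⟩ := hP
  obtain ⟨n, hn, hnQ⟩ := hQ
  have hNP : (m * n) • P ∈ kernel (NormedField.valuation (K := K)) (curveK p K M) := by
    rw [mul_nsmul]
    exact (kernel (NormedField.valuation (K := K)) (curveK p K M)).nsmul_mem hmP n
  have hNQ : (m * n) • Q ∈ kernel (NormedField.valuation (K := K)) (curveK p K M) := by
    rw [mul_nsmul']
    exact (kernel (NormedField.valuation (K := K)) (curveK p K M)).nsmul_mem hnQ m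
  have hNPQ : (m * n) • (P + Q) ∈ kernel (NormedField.valuation (K := K)) (curveK p K M) := by
    rw [nsmul_add]
    exact (kernel (NormedField.valuation (K := K)) (curveK p K M)).add_mem hNP hNQ
  rw [satLog_eq_div (Nat.mul_pos hm hn) hNPQ, satLog_eq_div (Nat.mul_pos hm hn) hNP,
    satLog_eq_div (Nat.mul_pos hm hn) hNQ, nsmul_add, ptLog_add hNP hNQ, add_div]

variable (p K M) in
/-- **The saturated logarithm as a homomorphism `Λ̃ : Ẽ₁(K) →+ K`.** [cite: SilvermanAEC2009, IV.6.4 and VII.6.3] -/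
def satLogHom : satKernel p K M →+ K where
  toFun P := satLog p K M P
  map_zero' := satLog_zero
  map_add' P Q := satLog_add P.2 Q.2

/-- `satLogHom` is `satLog`. [folklore] -/
@[simp] theorem satLogHom_apply (P : satKernel p K M) : satLogHom p K M P = satLog p K M P := rfl

/-- `Λ̃(-P) = -Λ̃(P)` on `Ẽ₁(K)`. [folklore] -/
theorem satLog_neg {P : (curveK p K M).toAffine.Point} (hP : P ∈ satKernel p K M) :
    satLog p K M (-P) = -satLog p K M P := by
  have h := map_neg (satLogHom p K M) ⟨P, hP⟩
  exact h

/-- `Λ̃(P - Q) = Λ̃(P) - Λ̃(Q)` on `Ẽ₁(K)`. [folklore] -/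
theorem satLog_sub {P Q : (curveK p K M).toAffine.Point} (hP : P ∈ satKernel p K M)
    (hQ : Q ∈ satKernel p K M) : satLog p K M (P - Q) = satLog p K M P - satLog p K M Q := by
  have h := map_sub (satLogHom p K M) ⟨P, hP⟩ ⟨Q, hQ⟩
  exact h

/-- `Λ̃(n • P) = n Λ̃(P)` on `Ẽ₁(K)`. [folklore] -/
theorem satLog_nsmul {P : (curveK p K M).toAffine.Point} (hP : P ∈ satKernel p K M) (n : ℕ) :
    satLog p K M (n • P) = n * satLog p K M P := by
  have h := map_nsmul (satLogHom p K M) n ⟨P, hP⟩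
  rw [nsmul_eq_mul] at h
  exact h

/-- `Λ̃(n • P) = n Λ̃(P)` on `Ẽ₁(K)`, `n ∈ ℤ`. [folklore] -/
theorem satLog_zsmul {P : (curveK p K M).toAffine.Point} (hP : P ∈ satKernel p K M) (n : ℤ) :
    satLog p K M (n • P) = n * satLog p K M P := by
  have h := map_zsmul (satLogHom p K M) n ⟨P, hP⟩
  rw [zsmul_eq_mul] at h
  exact h

/-- **`n Λ̃(P) = Λ(n • P)`** whenever `n • P ∈ E₁(K)`. [folklore] -/
theorem nat_mul_satLog {P : (curveK p K M).toAffine.Point} {n : ℕ} (hn : 0 < n)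
    (hP : n • P ∈ kernel (NormedField.valuation (K := K)) (curveK p K M)) :
    (n : K) * satLog p K M P = ptLog p K M (n • P) := by
  haveI : CharZero K := charZero_of_injective_algebraMap (algebraMap ℚ_[p] K).injective
  rw [satLog_eq_div hn hP, mul_div_cancel₀ _ (Nat.cast_ne_zero.mpr hn.ne')]

/-! ## §4 Norm bounds -/

/-- **`‖Λ̃(P)‖ ≤ B` as soon as `‖Λ(n • P)‖ ≤ B ‖n‖`** for one `n ≥ 1` with `n • P ∈ E₁(K)`.
[cite: SilvermanAEC2009, IV.6.4] -/
theorem norm_satLog_le_of_norm_ptLog_le {P : (curveK p K M).toAffine.Point} {n : ℕ} (hn : 0 < n)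
    (hP : n • P ∈ kernel (NormedField.valuation (K := K)) (curveK p K M)) {B : ℝ}
    (hB : ‖ptLog p K M (n • P)‖ ≤ B * ‖(n : K)‖) : ‖satLog p K M P‖ ≤ B := by
  haveI : CharZero K := charZero_of_injective_algebraMap (algebraMap ℚ_[p] K).injective
  have hn0 : 0 < ‖(n : K)‖ := norm_pos_iff.mpr (Nat.cast_ne_zero.mpr hn.ne')
  rw [satLog_eq_div hn hP, norm_div, div_le_iff₀ hn0]
  exact hB

/-- **The SAT₀ shape: if `p • P ∈ E₁(K)` and `‖Λ(p • P)‖ ≤ ‖p‖` then `‖Λ̃(P)‖ ≤ 1`** (at an additive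
prime over an unramified `K`: `p • E₀(K) ⊆ E₁(K)` and `Λ(E₁(K)) ⊆ p𝒪_K`, sibling file
`…KPortUnramified`). [cite: SilvermanAEC2009, IV.6.4 and Prop. VII.2.2] -/
theorem norm_satLog_le_one_of_prime_nsmul {P : (curveK p K M).toAffine.Point}
    (hP : p • P ∈ kernel (NormedField.valuation (K := K)) (curveK p K M))
    (hB : ‖ptLog p K M (p • P)‖ ≤ ‖(p : K)‖) : ‖satLog p K M P‖ ≤ 1 :=
  norm_satLog_le_of_norm_ptLog_le hp.out.pos hP (by rw [one_mul]; exact hB)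

/-- On `E₁(K)` itself: `‖Λ̃(P)‖ = ‖Λ(P)‖`. [folklore] -/
theorem norm_satLog_of_mem {P : (curveK p K M).toAffine.Point}
    (hP : P ∈ kernel (NormedField.valuation (K := K)) (curveK p K M)) :
    ‖satLog p K M P‖ = ‖ptLog p K M P‖ := by
  rw [satLog_of_mem hP]

end Summit.BirchSwinnertonDyer.BirchSwinnertonDyer.Theorems.KPort

end
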